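import Literature.Geometry.Riemannian.KarpukhinSternBochner
import Literature.Geometry.Lorentzian.DivergenceTheorem
import HarnessLib

/-!
# Karpukhin–Stern: stationarity of smooth harmonic maps into spheres under domain variations
(eighth proof file of `KarpukhinSternHarmonicMaps.lean`; topic `Geometry/Riemannian`)

First brick of the energy monotonicity inequality (hypothesis `hmono` of
`karpukhinStern_groundStateHarmonicMap_of_thm32_of_monotonicity_of_gap`,
`KarpukhinSternReduction.lean`; KS p. 751: "the well-known energy-monotonicity properties of
stationary harmonic maps"): a smooth harmonic map `u : N → Sᵏ` (`Δuᵢ = −|du|² uᵢ`) on a closed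
Riemannian manifold is **stationary with respect to domain variations**,

  `∫_N |du|² div X dμ = 2 ∫_N ∑ᵢ duᵢ(∇_{∇uᵢ} X) dμ`   for every smooth vector field `X`

(`integral_energyDensity_mul_vectorDivergence`) — the weak form of `div S = 0` for the
stress–energy tensor `S = ½|du|² g − ∑ᵢ duᵢ ⊗ duᵢ`. Proof: Green's identity
(`GreenIdentity.lean`) for `φᵢ = duᵢ(X)`, the Hessian identity
`dφᵢ(∇uᵢ) = Hess uᵢ(∇uᵢ, X) + duᵢ(∇_{∇uᵢ} X)` (`hessian_apply_holds`),
`∑ᵢ Hess uᵢ(∇uᵢ, X) = ½ X(|du|²)` (`mvfderiv_gradSq_apply`, symmetry of the Hessian), the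
divergence theorem `∫ ½ X(|du|²) = −∫ ½ |du|² div X` (`DivergenceTheorem.lean`), and
`∑ᵢ φᵢ Δuᵢ = −|du|² ∑ᵢ uᵢ duᵢ(X) = 0`. Everything is proved; no definitions, no named facts.

## References

* M. Karpukhin, D. Stern, *Existence of harmonic maps and eigenvalue optimization in higher
  dimensions*, Invent. Math. 236 (2024) 713–778, proof of Lemma 3.6, p. 751. [KarpukhinStern2024]
* J. M. Lee, *Introduction to Riemannian Manifolds*, 2nd ed. (2018), Problem 2-22 (divergence
  theorem). [Lee2018]
-/

noncomputable section

open Module Finset Filter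
open scoped InnerProductSpace BigOperators Manifold ContDiff Topology ENNReal

namespace Literature.Geometry.Riemannian

namespace KarpukhinStern

section FirstVariation

open Lorentzian Lorentzian.PseudoRiemannianMetric Bundle
open _root_.MeasureTheory

variable {m : ℕ} {H' : Type*} [TopologicalSpace H']
  {J : ModelWithCorners ℝ (EuclideanSpace ℝ (Fin m)) H'} [J.Boundaryless]
  {N : Type*} [TopologicalSpace N] [ChartedSpace H' N] [IsManifold J ∞ N] [CompactSpace N]
  [T2Space N] [MeasurableSpace N] [BorelSpace N]
  (h : ContMDiffRiemannianMetric J ∞ (EuclideanSpace ℝ (Fin m)) (TangentSpace J : N → Type _))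
  [(ofRiemannian h).HasLeviCivita]

/-- **Stationarity of smooth harmonic maps into spheres under domain variations** (the first
variation of the energy along the flow of a vector field `X`; equivalently, the stress–energy
tensor `S = ½|du|² g − ∑ᵢ duᵢ ⊗ duᵢ` of a harmonic map is divergence free): for a smooth harmonic
`u : N → Sᵏ` on a closed Riemannian manifold and every smooth vector field `X`,
`∫ |du|² div X dμ = 2 ∫ ∑ᵢ duᵢ(∇_{∇uᵢ} X) dμ`. Proof: Green's identity for `φᵢ = duᵢ(X)`,
`∫ φᵢ Δuᵢ = −∫ dφᵢ(∇uᵢ)`; the Hessian identity `dφᵢ(∇uᵢ) = Hess uᵢ(∇uᵢ, X) + duᵢ(∇_{∇uᵢ} X)`;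
`∑ᵢ Hess uᵢ(∇uᵢ, X) = ½ X|du|²`; the divergence theorem `∫ ½ X|du|² = −∫ ½|du|² div X`; and
`∑ᵢ φᵢ Δuᵢ = −|du|² ∑ᵢ uᵢ duᵢ(X) = 0`. The input of the energy monotonicity formula invoked in
the proof of KS Lemma 3.6 (p. 751, "energy-monotonicity properties of stationary harmonic maps").
[cite: KarpukhinStern2024, proof of Lemma 3.6, p. 751] -/
theorem integral_energyDensity_mul_vectorDivergence {k : ℕ}
    {u : N → Metric.sphere (0 : EuclideanSpace ℝ (Fin (k + 1))) 1} (hu : ContMDiff J (𝓡 k) ∞ u)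
    (harm : ∀ (i : Fin (k + 1)) (x : N), (ofRiemannian h).dalembertian
      (fun y ↦ (u y : EuclideanSpace ℝ (Fin (k + 1))) i) x =
        -(energyDensity h u x) * (u x : EuclideanSpace ℝ (Fin (k + 1))) i)
    {X : Π x : N, TangentSpace J x} (hX : CMDiff ∞ (T% X)) :
    ∫ x, energyDensity h u x * (ofRiemannian h).vectorDivergence X x ∂riemannianMeasure h =
      2 * ∫ x, ∑ i : Fin (k + 1),
        mvfderiv J (fun y ↦ (u y : EuclideanSpace ℝ (Fin (k + 1))) i) x
          ((ofRiemannian h).leviCivita X x ((ofRiemannian h).sharp x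
            (mvfderiv J (fun y ↦ (u y : EuclideanSpace ℝ (Fin (k + 1))) i) x).toLinearMap))
        ∂riemannianMeasure h := by
  set g := ofRiemannian h with hg
  set μ := riemannianMeasure h with hμ
  haveI := isFiniteMeasure_riemannianMeasure h
  set U : Fin (k + 1) → N → ℝ := fun i y ↦ (u y : EuclideanSpace ℝ (Fin (k + 1))) i with hUdef
  have hU : ∀ i, ContMDiff J 𝓘(ℝ, ℝ) ∞ (U i) := fun i ↦ contMDiff_sphereCoord hu i
  have h2le : (2 : ℕ∞ω) ≤ ((⊤ : ℕ∞) : ℕ∞ω) := by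
    rw [show (2 : ℕ∞ω) = ((2 : ℕ∞) : ℕ∞ω) from rfl]; exact WithTop.coe_le_coe.2 le_top
  have h1le : (1 : ℕ∞ω) ≤ ((⊤ : ℕ∞) : ℕ∞ω) := by
    rw [show (1 : ℕ∞ω) = ((1 : ℕ∞) : ℕ∞ω) from rfl]; exact WithTop.coe_le_coe.2 le_top
  have hU2 : ∀ i, CMDiff 2 (U i) := fun i ↦ (hU i).of_le h2le
  have hU1 : ∀ i, CMDiff 1 (U i) := fun i ↦ (hU i).of_le h1le
  have hX1 : CMDiff 1 (T% X) := hX.of_le h1le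
  -- the gradient fields `Vᵢ = ∇uᵢ` and the functions `φᵢ = duᵢ(X)`
  set V : Fin (k + 1) → Π x : N, TangentSpace J x := fun i x ↦
    g.sharp x (mvfderiv J (U i) x).toLinearMap with hVdef
  have hVd : ∀ i x, MDiffAt (T% (V i)) x := fun i x ↦ mdifferentiableAt_sharp_mvfderiv g (hU2 i x)
  set φ : Fin (k + 1) → N → ℝ := fun i y ↦ mvfderiv J (U i) y (X y) with hφdef
  have hφ1 : ∀ i, CMDiff 1 (φ i) := fun i x ↦ contMDiffAt_mvfderiv_apply (hU2 i x) (hX1 x)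
  -- the Hessian identity `dφᵢ(Vᵢ) = Hess uᵢ(Vᵢ, X) + duᵢ(∇_{Vᵢ} X)`
  have hhess : ∀ i x, mvfderiv J (φ i) x (V i x) =
      g.hessian (U i) x (V i x) (X x) + mvfderiv J (U i) x (g.leviCivita X x (V i x)) := by
    intro i x
    rw [hessian_apply_holds (hU2 i x) (hVd i x) ((hX1 x).mdifferentiableAt one_ne_zero)]
    simp only [PseudoRiemannianMetric.hessianAux, hφdef]
    ring
  -- `∑ᵢ Hess uᵢ(Vᵢ, X) = ½ d|du|²(X)`
  have hsumhess : ∀ x, ∑ i, g.hessian (U i) x (V i x) (X x) =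
      1 / 2 * mvfderiv J (energyDensity h u) x (X x) := by
    intro x
    have he : energyDensity h u = fun y ↦ ∑ i, g.gradSq (U i) y := by
      funext y; exact energyDensity_eq_sum_gradSq h u y
    have hdi : ∀ i, MDifferentiableAt J 𝓘(ℝ, ℝ) (g.gradSq (U i)) x := fun i ↦
      ((contMDiff_gradSq g (hU i)).mdifferentiableAt (by simp))
    rw [he, (mvfderiv_finset_sum Finset.univ (fun i _ ↦ hdi i)).2, _root_.sum_apply, Finset.mul_sum]
    refine Finset.sum_congr rfl fun i _ ↦ ?_
    rw [mvfderiv_gradSq_apply g (hU i)]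
    have hsy := (hessian_symm_holds (g := g) (f := U i) (hU2 i x)).eq (V i x) (X x)
    change g.hessian (U i) x (V i x) (X x) = 1 / 2 * (2 * g.hessian (U i) x (X x) (V i x))
    rw [hsy]
    ring
  -- the right-hand integrand `R = ∑ᵢ duᵢ(∇_{Vᵢ} X)` and the pointwise identity
  set R : N → ℝ := fun x ↦ ∑ i, mvfderiv J (U i) x (g.leviCivita X x (V i x)) with hRdef
  have hP : ∀ x, ∑ i, g.innerDual x (mvfderiv J (φ i) x).toLinearMap (mvfderiv J (U i) x).toLinearMap =
      1 / 2 * mvfderiv J (energyDensity h u) x (X x) + R x := by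
    intro x
    have h1 : ∀ i, g.innerDual x (mvfderiv J (φ i) x).toLinearMap (mvfderiv J (U i) x).toLinearMap =
        mvfderiv J (φ i) x (V i x) := fun i ↦ rfl
    simp only [h1, hhess, Finset.sum_add_distrib, hsumhess x, hRdef]
  -- continuity / integrability
  have hec : ContMDiff J 𝓘(ℝ, ℝ) ∞ (energyDensity h u) := contMDiff_energyDensity h hu
  have he1 : CMDiff 1 (energyDensity h u) := hec.of_le h1le
  have he2 : CMDiff 2 (energyDensity h u) := hec.of_le h2le
  have hdeXc : Continuous fun x ↦ mvfderiv J (energyDensity h u) x (X x) :=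
    continuous_iff_continuousAt.2 fun x ↦ (contMDiffAt_mvfderiv_apply (he2 x) (hX1 x)).continuousAt
  have hLc : ∀ i, Continuous fun x ↦
      g.innerDual x (mvfderiv J (φ i) x).toLinearMap (mvfderiv J (U i) x).toLinearMap :=
    fun i ↦ continuous_innerDual_mvfderiv g (hφ1 i) (hU1 i)
  have hsumLc : Continuous fun x ↦
      ∑ i, g.innerDual x (mvfderiv J (φ i) x).toLinearMap (mvfderiv J (U i) x).toLinearMap :=
    continuous_finsetSum _ fun i _ ↦ hLc i
  have hRc : Continuous R := by
    have : R = fun x ↦ (∑ i, g.innerDual x (mvfderiv J (φ i) x).toLinearMap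
        (mvfderiv J (U i) x).toLinearMap) - 1 / 2 * mvfderiv J (energyDensity h u) x (X x) := by
      funext x; rw [hP x]; ring
    rw [this]
    exact hsumLc.sub (continuous_const.mul hdeXc)
  obtain ⟨hdivc, -⟩ := integral_vectorDivergence_eq_zero h hX1
  -- Green for each `i`, summed: `∑ᵢ ∫ φᵢ Δuᵢ = −∫ (½ de(X) + R)`
  have hGreen : ∀ i, ∫ x, φ i x * g.dalembertian (U i) x ∂μ =
      -∫ x, g.innerDual x (mvfderiv J (φ i) x).toLinearMap (mvfderiv J (U i) x).toLinearMap ∂μ :=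
    fun i ↦ integral_mul_dalembertian_eq_neg_integral_innerDual h (hφ1 i) (hU2 i)
  -- the left side vanishes pointwise: `∑ᵢ φᵢ Δuᵢ = −e ∑ᵢ uᵢ duᵢ(X) = 0`
  have hzero : ∀ x, ∑ i, φ i x * g.dalembertian (U i) x = 0 := by
    intro x
    have hs := sum_sphereCoord_smul_mvfderiv hu x
    have hs' : ∑ i, U i x * mvfderiv J (U i) x (X x) = 0 := by
      have := congrArg (fun T : TangentSpace J x →L[ℝ] ℝ ↦ T (X x)) hs
      simpa [_root_.sum_apply, smul_apply] using this
    calc ∑ i, φ i x * g.dalembertian (U i) x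
        = ∑ i, -(energyDensity h u x) * (U i x * mvfderiv J (U i) x (X x)) := by
          refine Finset.sum_congr rfl fun i _ ↦ ?_
          rw [harm i x]; simp only [hφdef, hUdef]; ring
      _ = 0 := by rw [← Finset.mul_sum, hs', mul_zero]
  -- assemble
  have hIL : ∀ i, Integrable (fun x ↦ φ i x * g.dalembertian (U i) x) μ := fun i ↦
    integrable_of_continuous h ((hφ1 i).continuous.mul (contMDiff_dalembertian g (hU i)).continuous)
  have hIG : ∀ i, Integrable (fun x ↦ g.innerDual x (mvfderiv J (φ i) x).toLinearMap
      (mvfderiv J (U i) x).toLinearMap) μ := fun i ↦ integrable_of_continuous h (hLc i)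
  have hsum0 : ∑ i, ∫ x, φ i x * g.dalembertian (U i) x ∂μ = 0 := by
    rw [← integral_finsetSum _ (fun i _ ↦ hIL i)]
    simp only [hzero, integral_zero]
  have hsum1 : ∑ i, ∫ x, φ i x * g.dalembertian (U i) x ∂μ =
      -∫ x, (1 / 2 * mvfderiv J (energyDensity h u) x (X x) + R x) ∂μ := by
    simp only [hGreen, Finset.sum_neg_distrib]
    rw [← integral_finsetSum _ (fun i _ ↦ hIG i)]
    congr 1
    exact integral_congr_ae (Eventually.of_forall fun x ↦ hP x)
  have hdivX : ∫ x, energyDensity h u x * g.vectorDivergence X x ∂μ =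
      -∫ x, mvfderiv J (energyDensity h u) x (X x) ∂μ :=
    integral_mul_vectorDivergence_eq_neg_integral_mvfderiv h he1 hX1
  have hIde : Integrable (fun x ↦ 1 / 2 * mvfderiv J (energyDensity h u) x (X x)) μ :=
    integrable_of_continuous h (continuous_const.mul hdeXc)
  have hIR : Integrable R μ := integrable_of_continuous h hRc
  rw [hsum0, integral_add hIde hIR, integral_const_mul] at hsum1
  rw [hdivX]
  change -∫ x, mvfderiv J (energyDensity h u) x (X x) ∂μ = 2 * ∫ x, R x ∂μ
  linarith

end FirstVariation

end KarpukhinStern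

end Literature.Geometry.Riemannian
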